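import Summits.HubbardSuperconductivity.HubbardSuperconductivity.Theorems.NodalWardXYDefs

/-!
# `PerturbedXYOrder` (stmt-HubbardSuperconductivity-10739) — line `schwarz-inheritance`: `ℓ²` rigidity (exponent-3 tightness)

Stub `stub_e3L2Rigidity` of the lead skeleton `Cruxes/PerturbedXYOrder/Lines/schwarz_inheritance.lean`
(c5 tightness family: the exponent-THREE variant of the crux is false).  Pure finite-dimensional `ℓ²`
algebra on functions `Λ → ℝ`, `Λ = (ℤ/Lℤ)³`.  With `Q = Fin 3 → Fin (2^n)` (`#Q = q = 2^(3n)`),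
`ι y = fun k => ((y k : ℕ) : ZMod L)`, the site current `j(z) = Σ_i cur (z, i) θ` (`|j| ≤ 3`), the block
average `B z = (Σ_{y ∈ Q} j(z + ι y)) / q`, `S = Σ_z (B z)²` and the double block average
`T x = (Σ_{y, y' ∈ Q} j(x + ι y' - ι y)) / q²`:

* `⟨j, q² T⟩ = Σ_z (Σ_y j(z + ι y))²` (`l2_inner_eq`: expand the square, translate `x := z + ι y`);
* Jensen twice (`l2_block_sq_le`, `l2_double_sq_le`): `S ≤ Σ j²` and `Σ (T x)² ≤ S`;
* hence `Σ_x (j x - T x)² = Σ j² - 2S + Σ T² ≤ Σ j² - S ≤ 9L³ - S` and `S ≤ Σ j²` (`l2_main`), so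
  `S ≥ (1 - ρ) 9L³` gives `Σ (j - T j)² ≤ 9ρL³` and `Σ j² ≥ (1 - ρ) 9L³` (`stub_e3L2Rigidity`).

The algebra (`l2_*`) is stated for an arbitrary finite additive commutative group `G`, finite index type
`Q`, map `ι : Q → G` and function `f : G → ℝ`.
-/

noncomputable section

namespace Summit.HubbardSuperconductivity.HubbardSuperconductivity.Theorems.PerturbedXYOrder

open MeasureTheory Literature.Probability.LatticeModels
open Summit.HubbardSuperconductivity.HubbardSuperconductivity.Theses.NodalWardXY

section L2Algebra

variable {G Q : Type*} [AddCommGroup G] [Fintype G] [Fintype Q]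

/-- `⟨f, q² T f⟩ = Σ_z (Σ_y f (z + ι y))²`: the double block average is the adjoint-square of the
block sum (expand the square and translate `x := z + ι y`). -/
theorem l2_inner_eq (f : G → ℝ) (ι : Q → G) :
    ∑ x, f x * (∑ y, ∑ y', f (x + ι y' - ι y)) = ∑ z, (∑ y, f (z + ι y)) ^ 2 := by
  have lhs : ∑ x, f x * (∑ y, ∑ y', f (x + ι y' - ι y)) =
      ∑ y, ∑ y', ∑ x, f x * f (x + ι y' - ι y) := by
    simp_rw [Finset.mul_sum]
    rw [Finset.sum_comm]
    refine Finset.sum_congr rfl fun y _ => ?_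
    rw [Finset.sum_comm]
  have rhs : ∑ z, (∑ y, f (z + ι y)) ^ 2 = ∑ y, ∑ y', ∑ z, f (z + ι y) * f (z + ι y') := by
    simp_rw [sq, Finset.sum_mul_sum]
    rw [Finset.sum_comm]
    refine Finset.sum_congr rfl fun y _ => ?_
    rw [Finset.sum_comm]
  rw [lhs, rhs]
  refine Finset.sum_congr rfl fun y _ => Finset.sum_congr rfl fun y' _ => ?_
  exact Fintype.sum_equiv (Equiv.subRight (ι y)) _ _ fun x => by
    simp only [Equiv.subRight_apply, sub_add_cancel, sub_add_eq_add_sub]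

/-- Jensen for the block sum: `Σ_z (Σ_y f (z + ι y))² ≤ q² Σ_x (f x)²` (`q = #Q`; Cauchy–Schwarz in `y`,
then translation invariance of `Σ_z`). -/
theorem l2_block_sq_le (f : G → ℝ) (ι : Q → G) (q : ℝ) (hq : (Fintype.card Q : ℝ) = q) :
    ∑ z, (∑ y, f (z + ι y)) ^ 2 ≤ q ^ 2 * ∑ x, f x ^ 2 := by
  calc ∑ z, (∑ y, f (z + ι y)) ^ 2 ≤ ∑ z, (q * ∑ y, f (z + ι y) ^ 2) :=
        Finset.sum_le_sum fun z _ =>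
          sq_sum_le_card_mul_sum_sq.trans_eq (by rw [Finset.card_univ, hq])
    _ = q * ∑ y, ∑ z, f (z + ι y) ^ 2 := by rw [← Finset.mul_sum, Finset.sum_comm]
    _ = q * ∑ _y : Q, ∑ x, f x ^ 2 := by
        congr 1
        refine Finset.sum_congr rfl fun y _ => ?_
        exact Fintype.sum_equiv (Equiv.addRight (ι y)) _ _ fun x => rfl
    _ = q ^ 2 * ∑ x, f x ^ 2 := by
        rw [Finset.sum_const, Finset.card_univ, nsmul_eq_mul, hq]; ring

/-- Jensen for the double block sum: `Σ_x (Σ_{y,y'} f (x + ι y' - ι y))² ≤ q² Σ_z (Σ_y f (z + ι y))²`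
(`q = #Q`; regroup `x + ι y' - ι y = (x - ι y) + ι y'`, Cauchy–Schwarz in `y`, translation invariance). -/
theorem l2_double_sq_le (f : G → ℝ) (ι : Q → G) (q : ℝ) (hq : (Fintype.card Q : ℝ) = q) :
    ∑ x, (∑ y, ∑ y', f (x + ι y' - ι y)) ^ 2 ≤ q ^ 2 * ∑ z, (∑ y, f (z + ι y)) ^ 2 := by
  calc ∑ x, (∑ y, ∑ y', f (x + ι y' - ι y)) ^ 2
        ≤ ∑ x, (q * ∑ y, (∑ y', f (x + ι y' - ι y)) ^ 2) :=
        Finset.sum_le_sum fun x _ =>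
          sq_sum_le_card_mul_sum_sq.trans_eq (by rw [Finset.card_univ, hq])
    _ = q * ∑ y, ∑ x, (∑ y', f (x + ι y' - ι y)) ^ 2 := by rw [← Finset.mul_sum, Finset.sum_comm]
    _ = q * ∑ _y : Q, ∑ z, (∑ y', f (z + ι y')) ^ 2 := by
        congr 1
        refine Finset.sum_congr rfl fun y _ => ?_
        exact Fintype.sum_equiv (Equiv.subRight (ι y)) _ _ fun x => by
          simp only [Equiv.subRight_apply, sub_add_eq_add_sub]
    _ = q ^ 2 * ∑ z, (∑ y, f (z + ι y)) ^ 2 := by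
        rw [Finset.sum_const, Finset.card_univ, nsmul_eq_mul, hq]; ring

/-- **`ℓ²` rigidity, abstract form.** If `f² ≤ M` pointwise, `#Q = q > 0`, `q² = q₂`, `#G = N` and the
block functional `S = Σ_z ((Σ_y f (z + ι y)) / q)²` is at least `(1 - ρ) M N`, then
`Σ_x (f x - T x)² ≤ M ρ N` for the double block average `T x = (Σ_{y,y'} f (x + ι y' - ι y)) / q₂`, and
`(1 - ρ) M N ≤ Σ_x (f x)²`.  (`Σ (f - T)² = Σ f² - 2⟨f, T⟩ + Σ T²`, `⟨f, T⟩ = S`, `Σ T² ≤ S ≤ Σ f² ≤ M N`.) -/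
theorem l2_main (f : G → ℝ) (ι : Q → G) (q q₂ M N ρ : ℝ) (hq : (Fintype.card Q : ℝ) = q)
    (hq0 : 0 < q) (hq₂ : q ^ 2 = q₂) (hN : (Fintype.card G : ℝ) = N) (hM : ∀ x, f x ^ 2 ≤ M)
    (hS : (1 - ρ) * (M * N) ≤ ∑ z, ((∑ y, f (z + ι y)) / q) ^ 2) :
    (∑ x, (f x - (∑ y, ∑ y', f (x + ι y' - ι y)) / q₂) ^ 2 ≤ M * ρ * N) ∧
    ((1 - ρ) * (M * N) ≤ ∑ x, f x ^ 2) := by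
  have hP := l2_inner_eq f ι
  have hJ1 := l2_block_sq_le f ι q hq
  have hJ2 := l2_double_sq_le f ι q hq
  have hF : ∑ x, f x ^ 2 ≤ M * N := by
    calc ∑ x, f x ^ 2 ≤ ∑ _x : G, M := Finset.sum_le_sum fun x _ => hM x
      _ = M * N := by rw [Finset.sum_const, Finset.card_univ, nsmul_eq_mul, hN, mul_comm]
  have hS' : ∑ z, ((∑ y, f (z + ι y)) / q) ^ 2 = (∑ z, (∑ y, f (z + ι y)) ^ 2) / q ^ 2 := by
    rw [Finset.sum_div]
    exact Finset.sum_congr rfl fun z _ => div_pow _ _ _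
  rw [hS'] at hS
  have expand : ∑ x, (f x - (∑ y, ∑ y', f (x + ι y' - ι y)) / q₂) ^ 2 =
      ∑ x, f x ^ 2 - 2 / q₂ * ∑ x, f x * (∑ y, ∑ y', f (x + ι y' - ι y)) +
        1 / q₂ ^ 2 * ∑ x, (∑ y, ∑ y', f (x + ι y' - ι y)) ^ 2 := by
    rw [Finset.mul_sum, Finset.mul_sum, ← Finset.sum_sub_distrib, ← Finset.sum_add_distrib]
    refine Finset.sum_congr rfl fun x _ => ?_
    ring
  rw [expand, hP]
  subst hq₂
  have hq2 : 0 < q ^ 2 := by positivity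
  have hs : (∑ z, (∑ y, f (z + ι y)) ^ 2) / q ^ 2 ≤ ∑ x, f x ^ 2 := by
    rw [div_le_iff₀ hq2]; linarith
  refine ⟨?_, hS.trans hs⟩
  have h2 : 2 / q ^ 2 * ∑ z, (∑ y, f (z + ι y)) ^ 2 = 2 * ((∑ z, (∑ y, f (z + ι y)) ^ 2) / q ^ 2) := by
    ring
  have h3 : 1 / (q ^ 2) ^ 2 * ∑ x, (∑ y, ∑ y', f (x + ι y' - ι y)) ^ 2 ≤
      (∑ z, (∑ y, f (z + ι y)) ^ 2) / q ^ 2 := by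
    calc 1 / (q ^ 2) ^ 2 * ∑ x, (∑ y, ∑ y', f (x + ι y' - ι y)) ^ 2
        ≤ 1 / (q ^ 2) ^ 2 * (q ^ 2 * ∑ z, (∑ y, f (z + ι y)) ^ 2) :=
          mul_le_mul_of_nonneg_left hJ2 (by positivity)
      _ = (∑ z, (∑ y, f (z + ι y)) ^ 2) / q ^ 2 := by
          field_simp
  rw [h2]
  linarith

end L2Algebra

/-- **`ℓ²` rigidity (c5 tightness, exponent three).** If the block functional
`S_n(θ) = Σ_z ((Σ_{y ∈ Q_n} j_θ(z + ι y)) / 2^(3n))²` of the site current `j_θ(z) = Σ_i cur (z, i) θ`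
is at least `(1 - ρ) 9L³`, then `j_θ` is `ℓ²`-close to its double block average,
`Σ_x (j_θ x - (T_n j_θ) x)² ≤ 9ρL³`, and `Σ_x (j_θ x)² ≥ (1 - ρ) 9L³`.  (`l2_main` with `f = j_θ`,
`|j_θ| ≤ 3`, `#Q_n = 2^(3n)`, `#Λ = L³`.) -/
theorem stub_e3L2Rigidity (L : ℕ) [NeZero L] (θ : TorusSite 3 L → ℝ) (n : ℕ) (ρ : ℝ)
    (hS : (1 - ρ) * (9 * (L : ℝ) ^ 3) ≤ (∑ z : TorusSite 3 L, ((∑ y : Fin 3 → Fin (2 ^ n), ∑ i : Fin 3, cur (z + (fun k => ((y k : ℕ) : ZMod L)), i) θ) / (2 : ℝ) ^ (3 * n)) ^ 2)) :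
    (∑ x : TorusSite 3 L, ((∑ i : Fin 3, cur (x, i) θ) - ((∑ y : Fin 3 → Fin (2 ^ n), ∑ y' : Fin 3 → Fin (2 ^ n), ∑ i : Fin 3, cur (x + (fun k => ((y' k : ℕ) : ZMod L)) - (fun k => ((y k : ℕ) : ZMod L)), i) θ) / (2 : ℝ) ^ (6 * n))) ^ 2 ≤ 9 * ρ * (L : ℝ) ^ 3) ∧
    ((1 - ρ) * (9 * (L : ℝ) ^ 3) ≤ ∑ x : TorusSite 3 L, (∑ i : Fin 3, cur (x, i) θ) ^ 2) := by
  have hM : ∀ x : TorusSite 3 L, (∑ i : Fin 3, cur (x, i) θ) ^ 2 ≤ 9 := by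
    intro x
    have h1 : |∑ i : Fin 3, cur (x, i) θ| ≤ 3 := by
      calc |∑ i : Fin 3, cur (x, i) θ| ≤ ∑ i : Fin 3, |cur (x, i) θ| := Finset.abs_sum_le_sum_abs _ _
        _ ≤ ∑ _i : Fin 3, (1 : ℝ) := Finset.sum_le_sum fun i _ => Real.abs_sin_le_one _
        _ = 3 := by simp
    have h2 := abs_le.mp h1
    nlinarith [h2.1, h2.2]
  have hq : ((Fintype.card (Fin 3 → Fin (2 ^ n)) : ℕ) : ℝ) = (2 : ℝ) ^ (3 * n) := by
    rw [Fintype.card_fun, Fintype.card_fin, Fintype.card_fin]; push_cast; ring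
  have hN : ((Fintype.card (TorusSite 3 L) : ℕ) : ℝ) = (L : ℝ) ^ 3 := by
    rw [Fintype.card_fun, ZMod.card, Fintype.card_fin]; push_cast; ring
  have hq₂ : ((2 : ℝ) ^ (3 * n)) ^ 2 = (2 : ℝ) ^ (6 * n) := by
    rw [← pow_mul]; ring_nf
  exact l2_main (fun z : TorusSite 3 L => ∑ i : Fin 3, cur (z, i) θ)
    (fun (y : Fin 3 → Fin (2 ^ n)) (k : Fin 3) => ((y k : ℕ) : ZMod L)) _ _ 9 _ ρ hq (by positivity) hq₂ hN
    hM hS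

end Summit.HubbardSuperconductivity.HubbardSuperconductivity.Theorems.PerturbedXYOrder

end
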